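import Mathlib
import Summits.KontsevichZagierPeriods.Zeta5Search.WedgeDictionarySumRuleDilog
import Summits.KontsevichZagierPeriods.Zeta5Search.WedgeDictionaryOneTopSteps
import HarnessLib

/-!
# Level-1 sum rule of the wedge dictionary, II: the one-variable kernels of the five integrations (cell `pub-zeta5`, seat ct-1 g20)

HONEST FRAMING: systematic search; no irrationality claim unless certified.  Elementary real analysis only (companion of
`WedgeDictionarySumRuleDilog`, used by `WedgeDictionarySumRule`): the one-variable steps of the iterated integration of the SUM of
the two level-1 cellular integrands `I(1,0,1,0,1,1,1,1)` (axis) and `I(1,0,1,0,1,1,0,1)` (one-top), in the order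
`t₁, t₃, t₂, t₅, t₄`, as `ℝ≥0∞`-valued Lebesgue integrals of interval indicators (FTC each):

* `lintegral_kernel0`: `∫_{(0,b)} K·t(2c−t)/(c−t)² = K·b²/(c−b)` (the `t₁`-step: in the SUM the logarithms of the two
  separate `t₁`-integrations cancel — primitive `c²/(c−t) − t`);
* the `t₂`-step `∫_{(0,b)} K·t/(c−t)² = K·(b/(c−b) + log((c−b)/c))` (where the logarithm enters) is the tree's
  `WedgeDictionaryOneTop.lintegral_t1` (not restated here; ct-1 g21);
* `lintegral_kernel3`: the `t₅`-step `∫_{(a,1)} (s−a)(1−s)/(a(1−a)²)·(a/(s−a) + log((s−a)/s)) ds = G₄(a)` — an explicit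
  polynomial–logarithmic primitive (`hasDerivAt_prim3`, continuous on `[a,1]` through `x ↦ x log x`), the non-negativity of the
  integrand (`log u ≥ 1 − 1/u`), hence `G₄ ≥ 0` on `(0,1)`;
* `lintegral_G4`: the `t₄`-step `∫⁻_{(0,1)} G₄ = 5/6 − π²/18` (from `integral_G4` of part I).
(The `t₃`-step is the tree's `WedgeDictionaryTopPairIntegral.lintegral_div_sq_sub`.)  Theorems only; `G₄` is a local notation.
-/

noncomputable section

open MeasureTheory Set Filter Topology intervalIntegral

namespace Summit.KontsevichZagierPeriods.Zeta5Search.WedgeDictionarySumRule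

open Summit.KontsevichZagierPeriods.Zeta5Search.WedgeDictionaryOneTop (t1_nonneg)

/-- `G₄(a) = 1/2 + (1−a)log(1−a)/(6a) − 1/(3(1−a)) + a(a−3)log a/(6(1−a)²)` (local notation, as in part I). -/
local notation "G4" => (fun a : ℝ => 1 / 2 + (1 - a) * Real.log (1 - a) / (6 * a) - 1 / (3 * (1 - a)) +
  a * (a - 3) * Real.log a / (6 * (1 - a) ^ 2))

/-! ### The two rational kernels and the logarithmic kernel -/

/-- `∫_{(0,b)} K·t(2c−t)/(c−t)² dt = K·b²/(c−b)` for `K ≥ 0`, `0 ≤ b < c`. [folklore] -/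
theorem lintegral_kernel0 (K b c : ℝ) (hK : 0 ≤ K) (hb : 0 ≤ b) (hbc : b < c) :
    ∫⁻ t in Ioo 0 b, ENNReal.ofReal (K * (t * (2 * c - t) / (c - t) ^ 2)) =
      ENNReal.ofReal (K * (b ^ 2 / (c - b))) := by
  have hne : ∀ t ∈ uIcc 0 b, c - t ≠ 0 := by
    intro t ht h0; rw [uIcc_of_le hb] at ht; linarith [ht.2]
  have hcont : ContinuousOn (fun t : ℝ => K * (t * (2 * c - t) / (c - t) ^ 2)) (uIcc 0 b) := by
    refine continuousOn_const.mul (ContinuousOn.div (by fun_prop) (by fun_prop) ?_)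
    intro t ht; exact pow_ne_zero 2 (hne t ht)
  rw [← ofReal_integral_eq_lintegral_ofReal]
  · congr 1
    rw [← integral_Ioc_eq_integral_Ioo, ← intervalIntegral.integral_of_le hb]
    have hderiv : ∀ t ∈ uIcc 0 b, HasDerivAt (fun t : ℝ => K * (c ^ 2 / (c - t) - t))
        (K * (t * (2 * c - t) / (c - t) ^ 2)) t := by
      intro t ht
      have h1 := ((hasDerivAt_const t (c ^ 2)).div ((hasDerivAt_id' t).const_sub c) (hne t ht))
      have h := (h1.sub (hasDerivAt_id' t)).const_mul K
      refine h.congr_deriv ?_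
      have := hne t ht
      field_simp
      ring
    rw [intervalIntegral.integral_eq_sub_of_hasDerivAt hderiv hcont.intervalIntegrable]
    have hcb : c - b ≠ 0 := by linarith
    have hc : c ≠ 0 := by linarith
    field_simp
    ring
  · rw [uIcc_of_le hb] at hcont
    exact hcont.integrableOn_Icc.mono_set Ioo_subset_Icc_self
  · refine ae_restrict_of_forall_mem measurableSet_Ioo fun t ht => ?_
    have : 0 < 2 * c - t := by linarith [ht.2]
    have : 0 < t := ht.1
    positivity

/-! ### The logarithmic step: `∫_{(a,1)} g₃(a,s) ds = G₄(a)` -/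

/-- The primitive used in the logarithmic step (polynomial–logarithmic, continuous on `[a,1]`). [folklore] -/
theorem hasDerivAt_prim3 {a s : ℝ} (ha : 0 < a) (ha1 : a < 1) (hs : s ∈ Ioo a 1) :
    HasDerivAt (fun s : ℝ => -(1 - s) ^ 2 / (2 * (1 - a) ^ 2) +
        (((-2 * s ^ 2 + (3 + a) * s + (a ^ 2 - 3 * a)) / 6) * ((s - a) * Real.log (s - a))
          - (-s ^ 3 / 9 + (3 + a) * s ^ 2 / 12 + (a ^ 2 - 3 * a) * s / 6)
          - (-s ^ 3 / 3 + (1 + a) * s ^ 2 / 2 - a * s) * Real.log s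
          + (-s ^ 3 / 9 + (1 + a) * s ^ 2 / 4 - a * s)) / (a * (1 - a) ^ 2))
      ((1 - s) / (1 - a) ^ 2 + (s - a) * (1 - s) * (Real.log (s - a) - Real.log s) / (a * (1 - a) ^ 2)) s := by
  have hsa : s - a ≠ 0 := by have := hs.1; intro e; linarith
  have hs0 : s ≠ 0 := by have := hs.1; intro e; linarith
  have h1a : (1 - a) ≠ 0 := by intro e; linarith
  have ha0 : a ≠ 0 := ha.ne'
  -- building blocks
  have hid := hasDerivAt_id' s
  have hT1 : HasDerivAt (fun s : ℝ => -(1 - s) ^ 2 / (2 * (1 - a) ^ 2)) ((1 - s) / (1 - a) ^ 2) s := by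
    have h := (((hid.const_sub 1).pow 2).neg).div_const (2 * (1 - a) ^ 2)
    refine h.congr_deriv ?_
    field_simp
    ring
  have hml : HasDerivAt (fun s : ℝ => (s - a) * Real.log (s - a)) (Real.log (s - a) + 1) s := by
    have h2 : HasDerivAt (fun x : ℝ => x * Real.log x) (Real.log (s - a) + 1) (s - a) :=
      Real.hasDerivAt_mul_log hsa
    have h := h2.comp s (hid.sub_const a)
    rw [mul_one] at h
    exact h
  have hq : HasDerivAt (fun s : ℝ => (-2 * s ^ 2 + (3 + a) * s + (a ^ 2 - 3 * a)) / 6)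
      ((-2 * (2 * s) + (3 + a)) / 6) s := by
    have h := ((((hid.pow 2).const_mul (-2)).add (hid.const_mul (3 + a))).add_const (a ^ 2 - 3 * a)).div_const 6
    refine h.congr_deriv ?_
    simp
  have hQ : HasDerivAt (fun s : ℝ => -s ^ 3 / 9 + (3 + a) * s ^ 2 / 12 + (a ^ 2 - 3 * a) * s / 6)
      (-(3 * s ^ 2) / 9 + (3 + a) * (2 * s) / 12 + (a ^ 2 - 3 * a) / 6) s := by
    have h := (((hid.pow 3).neg.div_const 9).add (((hid.pow 2).const_mul (3 + a)).div_const 12)).add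
      ((hid.const_mul (a ^ 2 - 3 * a)).div_const 6)
    refine h.congr_deriv ?_
    simp
  have hP2 : HasDerivAt (fun s : ℝ => -s ^ 3 / 3 + (1 + a) * s ^ 2 / 2 - a * s)
      (-(3 * s ^ 2) / 3 + (1 + a) * (2 * s) / 2 - a) s := by
    have h := (((hid.pow 3).neg.div_const 3).add (((hid.pow 2).const_mul (1 + a)).div_const 2)).sub
      (hid.const_mul a)
    refine h.congr_deriv ?_
    simp
  have hlog : HasDerivAt (fun s : ℝ => Real.log s) (1 / s) s := by
    simpa [one_div] using Real.hasDerivAt_log hs0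
  have hQ2 : HasDerivAt (fun s : ℝ => -s ^ 3 / 9 + (1 + a) * s ^ 2 / 4 - a * s)
      (-(3 * s ^ 2) / 9 + (1 + a) * (2 * s) / 4 - a) s := by
    have h := (((hid.pow 3).neg.div_const 9).add (((hid.pow 2).const_mul (1 + a)).div_const 4)).sub
      (hid.const_mul a)
    refine h.congr_deriv ?_
    simp
  have hbig := (((hq.mul hml).sub hQ).sub (hP2.mul hlog)).add hQ2
  have hall := hT1.add (hbig.div_const (a * (1 - a) ^ 2))
  refine hall.congr_deriv ?_
  field_simp
  ring

/-- The value of the primitive difference: `Φ₃(1) − Φ₃(a) = G₄(a)`. [folklore] -/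
theorem prim3_diff {a : ℝ} (ha : 0 < a) (ha1 : a < 1) :
    (fun s : ℝ => -(1 - s) ^ 2 / (2 * (1 - a) ^ 2) +
        (((-2 * s ^ 2 + (3 + a) * s + (a ^ 2 - 3 * a)) / 6) * ((s - a) * Real.log (s - a))
          - (-s ^ 3 / 9 + (3 + a) * s ^ 2 / 12 + (a ^ 2 - 3 * a) * s / 6)
          - (-s ^ 3 / 3 + (1 + a) * s ^ 2 / 2 - a * s) * Real.log s
          + (-s ^ 3 / 9 + (1 + a) * s ^ 2 / 4 - a * s)) / (a * (1 - a) ^ 2)) 1 -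
    (fun s : ℝ => -(1 - s) ^ 2 / (2 * (1 - a) ^ 2) +
        (((-2 * s ^ 2 + (3 + a) * s + (a ^ 2 - 3 * a)) / 6) * ((s - a) * Real.log (s - a))
          - (-s ^ 3 / 9 + (3 + a) * s ^ 2 / 12 + (a ^ 2 - 3 * a) * s / 6)
          - (-s ^ 3 / 3 + (1 + a) * s ^ 2 / 2 - a * s) * Real.log s
          + (-s ^ 3 / 9 + (1 + a) * s ^ 2 / 4 - a * s)) / (a * (1 - a) ^ 2)) a = G4 a := by
  have h1a : (1 - a) ≠ 0 := by intro e; linarith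
  have ha0 : a ≠ 0 := ha.ne'
  simp only [sub_self, Real.log_one, mul_zero, Real.log_zero]
  field_simp
  ring

/-- Continuity of the primitive on `[a, 1]`. [folklore] -/
theorem continuousOn_prim3 {a : ℝ} (ha : 0 < a) :
    ContinuousOn (fun s : ℝ => -(1 - s) ^ 2 / (2 * (1 - a) ^ 2) +
        (((-2 * s ^ 2 + (3 + a) * s + (a ^ 2 - 3 * a)) / 6) * ((s - a) * Real.log (s - a))
          - (-s ^ 3 / 9 + (3 + a) * s ^ 2 / 12 + (a ^ 2 - 3 * a) * s / 6)
          - (-s ^ 3 / 3 + (1 + a) * s ^ 2 / 2 - a * s) * Real.log s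
          + (-s ^ 3 / 9 + (1 + a) * s ^ 2 / 4 - a * s)) / (a * (1 - a) ^ 2)) (Icc a 1) := by
  have hc1 : Continuous fun s : ℝ => (s - a) * Real.log (s - a) :=
    Real.continuous_mul_log.comp (continuous_id.sub continuous_const)
  have hlogOn : ContinuousOn Real.log (Icc a 1) :=
    Real.continuousOn_log.mono fun s hs => by
      simp only [mem_compl_iff, mem_singleton_iff]; exact ne_of_gt (by linarith [hs.1])
  apply ContinuousOn.add
  · exact (by fun_prop : Continuous fun s : ℝ => -(1 - s) ^ 2 / (2 * (1 - a) ^ 2)).continuousOn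
  · apply ContinuousOn.div_const
    apply ContinuousOn.add
    · apply ContinuousOn.sub
      · apply ContinuousOn.sub
        · exact ((by fun_prop : Continuous fun s : ℝ => (-2 * s ^ 2 + (3 + a) * s + (a ^ 2 - 3 * a)) / 6).mul
            hc1).continuousOn
        · exact (by fun_prop : Continuous fun s : ℝ =>
            -s ^ 3 / 9 + (3 + a) * s ^ 2 / 12 + (a ^ 2 - 3 * a) * s / 6).continuousOn
      · exact (by fun_prop : Continuous fun s : ℝ => -s ^ 3 / 3 + (1 + a) * s ^ 2 / 2 - a * s).continuousOn.mul
          hlogOn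
    · exact (by fun_prop : Continuous fun s : ℝ => -s ^ 3 / 9 + (1 + a) * s ^ 2 / 4 - a * s).continuousOn

/-- Continuity of the expanded integrand of the logarithmic step on `[a, 1]`. [folklore] -/
theorem continuousOn_kernel3 {a : ℝ} (ha : 0 < a) :
    ContinuousOn (fun s : ℝ => (1 - s) / (1 - a) ^ 2 +
      (s - a) * (1 - s) * (Real.log (s - a) - Real.log s) / (a * (1 - a) ^ 2)) (Icc a 1) := by
  have hc1 : Continuous fun s : ℝ => (s - a) * Real.log (s - a) :=
    Real.continuous_mul_log.comp (continuous_id.sub continuous_const)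
  have hlogOn : ContinuousOn Real.log (Icc a 1) :=
    Real.continuousOn_log.mono fun s hs => by
      simp only [mem_compl_iff, mem_singleton_iff]; exact ne_of_gt (by linarith [hs.1])
  have e : (fun s : ℝ => (1 - s) / (1 - a) ^ 2 + (s - a) * (1 - s) * (Real.log (s - a) - Real.log s) / (a * (1 - a) ^ 2))
      = fun s => (1 - s) / (1 - a) ^ 2 +
        ((1 - s) * ((s - a) * Real.log (s - a)) - (s - a) * (1 - s) * Real.log s) / (a * (1 - a) ^ 2) := by
    funext s; ring
  rw [e]
  apply ContinuousOn.add
  · exact (by fun_prop : Continuous fun s : ℝ => (1 - s) / (1 - a) ^ 2).continuousOn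
  · apply ContinuousOn.div_const
    apply ContinuousOn.sub
    · exact ((by fun_prop : Continuous fun s : ℝ => (1 - s)).mul hc1).continuousOn
    · exact (by fun_prop : Continuous fun s : ℝ => (s - a) * (1 - s)).continuousOn.mul hlogOn

/-- **The logarithmic step as a real integral**: `∫_a^1 g₃(a,s) ds = G₄(a)` for `0 < a < 1`. [folklore] -/
theorem integral_kernel3 {a : ℝ} (ha : 0 < a) (ha1 : a < 1) :
    ∫ s in a..1, ((1 - s) / (1 - a) ^ 2 + (s - a) * (1 - s) * (Real.log (s - a) - Real.log s) / (a * (1 - a) ^ 2)) =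
      G4 a := by
  rw [intervalIntegral.integral_eq_sub_of_hasDerivAt_of_le ha1.le (continuousOn_prim3 ha)
    (fun s hs => hasDerivAt_prim3 ha ha1 hs) ((continuousOn_kernel3 ha).intervalIntegrable_of_Icc ha1.le)]
  exact prim3_diff ha ha1

/-- The product form of the integrand on `(a, 1)`. [folklore] -/
theorem kernel3_eq {a s : ℝ} (ha : 0 < a) (hs : s ∈ Ioo a 1) :
    (s - a) * (1 - s) / (a * (1 - a) ^ 2) * (a / (s - a) + Real.log ((s - a) / s)) =
      (1 - s) / (1 - a) ^ 2 + (s - a) * (1 - s) * (Real.log (s - a) - Real.log s) / (a * (1 - a) ^ 2) := by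
  have hsa : s - a ≠ 0 := by have := hs.1; intro e; linarith
  have hs0 : s ≠ 0 := by have := hs.1; intro e; linarith
  have h1a : 1 - a ≠ 0 := by have := hs.2; intro e; linarith [hs.1]
  have ha0 : a ≠ 0 := ha.ne'
  rw [Real.log_div hsa hs0]
  field_simp

/-- Non-negativity of the integrand on `[a, 1]`. [folklore] -/
theorem kernel3_nonneg_Icc {a s : ℝ} (ha : 0 < a) (ha1 : a < 1) (hs : s ∈ Icc a 1) :
    0 ≤ (1 - s) / (1 - a) ^ 2 + (s - a) * (1 - s) * (Real.log (s - a) - Real.log s) / (a * (1 - a) ^ 2) := by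
  rcases eq_or_lt_of_le hs.1 with h | h
  · subst h
    have : 0 ≤ 1 - a := by linarith [hs.2]
    simp only [sub_self, zero_mul, zero_div, add_zero]
    positivity
  rcases eq_or_lt_of_le hs.2 with h' | h'
  · subst h'; simp
  · rw [← kernel3_eq ha ⟨h, h'⟩]
    have h1 : 0 ≤ s - a := by linarith
    have h2 : 0 ≤ 1 - s := by linarith
    have h3 : 0 ≤ 1 - a := by linarith
    have := t1_nonneg ha h
    positivity

/-- `G₄ ≥ 0` on `(0,1)`. [folklore] -/
theorem G4_nonneg {a : ℝ} (ha : 0 < a) (ha1 : a < 1) : 0 ≤ G4 a := by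
  rw [← integral_kernel3 ha ha1]
  exact intervalIntegral.integral_nonneg ha1.le fun s hs => kernel3_nonneg_Icc ha ha1 hs

/-- **The logarithmic step, `ℝ≥0∞` form** (product-form integrand, as produced by the previous step). [folklore] -/
theorem lintegral_kernel3 {a : ℝ} (ha : 0 < a) (ha1 : a < 1) :
    ∫⁻ s in Ioo a 1, ENNReal.ofReal ((s - a) * (1 - s) / (a * (1 - a) ^ 2) * (a / (s - a) + Real.log ((s - a) / s))) =
      ENNReal.ofReal (G4 a) := by
  rw [setLIntegral_congr_fun measurableSet_Ioo (fun s hs => by rw [kernel3_eq ha hs])]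
  rw [← ofReal_integral_eq_lintegral_ofReal]
  · rw [← integral_Ioc_eq_integral_Ioo, ← intervalIntegral.integral_of_le ha1.le, integral_kernel3 ha ha1]
  · exact ((continuousOn_kernel3 ha).integrableOn_Icc).mono_set Ioo_subset_Icc_self
  · exact ae_restrict_of_forall_mem measurableSet_Ioo fun s hs => kernel3_nonneg_Icc ha ha1 (Ioo_subset_Icc_self hs)

/-! ### The last step, `ℝ≥0∞` form -/

/-- `∫⁻_{(0,1)} G₄ = 5/6 − π²/18`. [folklore] -/
theorem lintegral_G4 : ∫⁻ a in Ioo (0 : ℝ) 1, ENNReal.ofReal (G4 a) = ENNReal.ofReal (5 / 6 - Real.pi ^ 2 / 18) := by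
  rw [← ofReal_integral_eq_lintegral_ofReal integral_G4.1
    (ae_restrict_of_forall_mem measurableSet_Ioo fun a ha => G4_nonneg ha.1 ha.2), integral_G4.2]

end Summit.KontsevichZagierPeriods.Zeta5Search.WedgeDictionarySumRule

end
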